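import Summits.AtomisticToContinuum.BoseEinsteinCondensation.Theorems.BlockLatticeFSumDirichletFloor

/-!
# The block floor F♭ for TRANSLATED Dirichlet states (the shift classes `s ≠ 0` of MF «BoxMixedFloor», decomp-a2c hand-2 g8)

Complement of `BlockLatticeFSumDirichletFloor` (shift `0`): a Dirichlet trial state `Ψ` of the open box `(0,L)^{3N}` translated by a
one-particle vector `a` with `0 ≤ a_k` and `a_k + L ≤ L'` is a `C¹` Bose-symmetric function supported in the cell `[0,L')^{3N}`, with the same
normalisation and the same energy (`kineticDensity_translate`, `interaction_sub_const`), and its sub-cell occupations are those of `Ψ` in the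
BACK-TRANSLATED modes `x ↦ u_q(x + a)` (`occupation_comp_add`).  Hence `dirichletBudgetBlockFloor_shift`: F♭'s conclusion for
`∑_q ⟨u_q(· + a), γ_Ψ u_q(· + a)⟩`, which for `a = (L/K)·s`, `L' = (K/2+1)·(2L/K)` (or `(K/2+2)·(2L/K)`) is exactly the discounted mixed floor
`∑_m n(pieceMode L K s m)` of lens-6 g29's `BoxLatticeFSumCarving.BoxMixedFloor` — leaving to MF's prover only the Dyson budget and the
`ρ ↦ N/L'³` window bookkeeping.  `[folklore]` / [LSSY2005, Thm 5.1]; no definitions, no `sorry`.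
-/

noncomputable section

open MeasureTheory Set
open scoped ENNReal NNReal BigOperators ComplexConjugate

namespace Summit.AtomisticToContinuum.BoseEinsteinCondensation.Theorems.BlockLatticeFSumDirichletFloorShift

open Literature.MathematicalPhysics.QuantumManyBody.BoseGas
open Summit.AtomisticToContinuum.BoseEinsteinCondensation.Theorems.BlockCondensation (cellNBudgetBlockFloor_holds)

variable {N : ℕ} {L L' : ℝ}

/-- **Occupations of a translated state are occupations in back-translated modes**:
`⟨φ, γ_{Ψ(· − a⃗)} φ⟩ = ⟨φ(· + a), γ_Ψ φ(· + a)⟩` (joint translation invariance of occupations; cf. the tree's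
`BECInfraredBoundDepletionCounting.occupation_translate`, whose module is not built on the farm at the time of writing). [folklore] -/
theorem occupation_comp_add (N : ℕ) (φ : Space → ℂ) (Ψ : Config N → ℂ) (a : Space) :
    occupation N φ (fun X => Ψ (X - fun _ => a)) = occupation N (fun x => φ (x + a)) Ψ := by
  cases N with
  | zero => rfl
  | succ n =>
    simp only [occupation]
    congr 1
    have hvec : ∀ (x : Space) (Y : Config n),
        (Matrix.vecCons x Y - fun _ => a) = Matrix.vecCons (x - a) (Y - fun _ => a) := by
      intro x Y
      ext i
      refine Fin.cases ?_ (fun j => ?_) i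
      · simp
      · simp
    have hinner : ∀ Y : Config n,
        ∫ x, conj (φ x) * Ψ (Matrix.vecCons x Y - fun _ => a) =
          ∫ x, conj (φ (x + a)) * Ψ (Matrix.vecCons x (Y - fun _ => a)) := by
      intro Y
      simp_rw [hvec]
      have h := integral_add_right_eq_self (μ := (volume : Measure Space))
        (fun x => conj (φ x) * Ψ (Matrix.vecCons (x - a) (Y - fun _ => a))) a
      simp only [add_sub_cancel_right] at h
      exact h.symm
    simp_rw [hinner]
    exact lintegral_sub_right_eq_self (μ := (volume : Measure (Config n)))
      (fun Y => (‖∫ x, conj (φ (x + a)) * Ψ (Matrix.vecCons x Y)‖₊ : ℝ≥0∞) ^ 2) (fun _ => a)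

/-- A translated Dirichlet state is supported in every cell containing the translated box: if `0 ≤ a_k` and `a_k + L ≤ L'` then
`Ψ(X − a⃗) ≠ 0 ⟹ X ∈ [0,L')^{3N}`. [folklore] -/
theorem mem_cellN_of_translate_ne_zero (Ψ : TrialState N L) {a : Space} (ha0 : ∀ k, 0 ≤ a k) (haL : ∀ k, a k + L ≤ L')
    {X : Config N} (hX : Ψ.ψ (X - fun _ => a) ≠ 0) : X ∈ cellN N L' := by
  have hb : (X - fun _ => a) ∈ boxN N L := by
    by_contra h
    exact hX (Ψ.eq_zero _ h)
  intro i k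
  have hk := hb i k
  simp only [Pi.sub_apply, PiLp.sub_apply, Set.mem_Ioo] at hk
  exact ⟨by linarith [ha0 k, hk.1], by linarith [haL k, hk.2]⟩

/-- **F♭ for translated Dirichlet states.**  For every repulsive finite-range `v`, `A > 0`, `η > 0` there are `ρ₀, τ > 0`, `N₀` such that for all
`N ≥ N₀`, `0 < L'`, shifts `a` with `0 ≤ a_k`, `a_k + L ≤ L'`, `N ≤ ρ₀ L'³`, every Dirichlet state `Ψ : TrialState N L` with
`energy v Ψ ≤ (4πa + τ)(N/L'³)N` has `∑_q ⟨u_q(· + a), γ_Ψ u_q(· + a)⟩ ≥ (1−η)N` over the `K³` sub-cell modes of side `L'/K`, for every even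
`K > 0` with `L'/K` in the GP window of the density `N/L'³`. [cite: LSSY2005, Thm. 5.1 (5.15)–(5.17); folklore (translation)] -/
theorem dirichletBudgetBlockFloor_shift :
    ∀ v : ℝ → ℝ≥0∞, IsRepulsiveFiniteRange v → ∀ A : ℝ, 0 < A → ∀ η : ℝ, 0 < η →
      ∃ ρ₀ : ℝ, 0 < ρ₀ ∧ ∃ τ : ℝ, 0 < τ ∧ ∃ N₀ : ℕ, ∀ (N : ℕ) (L L' : ℝ) (a : Space), 0 < L' →
        (∀ k, 0 ≤ a k) → (∀ k, a k + L ≤ L') → N₀ ≤ N →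
        (N : ℝ) ≤ ρ₀ * L' ^ 3 → ∀ Ψ : TrialState N L,
          energy v Ψ ≤ ENNReal.ofReal ((4 * Real.pi * (scatteringLength v).toReal + τ) * ((N : ℝ) / L' ^ 3) * N) →
          ∀ K : ℕ, Even K → 0 < K →
            A / Real.sqrt ((N : ℝ) / L' ^ 3) ≤ L' / (K : ℝ) ∧ L' / (K : ℝ) ≤ 2 * A / Real.sqrt ((N : ℝ) / L' ^ 3) →
            ENNReal.ofReal ((1 - η) * N) ≤
              ∑ q : SubIdx K, occupation N (fun x => subMode (L' / (K : ℝ)) q (x + a)) Ψ.ψ := by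
  intro v hv A hA η hη
  obtain ⟨ρ₀, hρ₀, τ, hτ, N₀, H⟩ := cellNBudgetBlockFloor_holds v hv A hA η hη
  refine ⟨ρ₀, hρ₀, τ, hτ, N₀, ?_⟩
  intro N L L' a hL' ha0 haL hN hNρ Ψ hE K hK hK0 hwin
  -- the translated state
  set ψa : Config N → ℂ := fun X => Ψ.ψ (X - fun _ => a) with hψa
  have hC1 : ContDiff ℝ 1 ψa := Ψ.contDiff.comp (contDiff_id.sub contDiff_const)
  have hsymm : ∀ (σ : Equiv.Perm (Fin N)) (X : Config N), ψa (X ∘ σ) = ψa X := by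
    intro σ X
    have h : ((X ∘ σ) - fun _ => a) = (X - fun _ => a) ∘ σ := rfl
    simp only [hψa, h, Ψ.symm]
  have hsupp : ∀ X, ψa X ≠ 0 → X ∈ cellN N L' := fun X hX => mem_cellN_of_translate_ne_zero Ψ ha0 haL hX
  have hind : (cellN N L').indicator ψa = ψa := by
    funext X
    by_cases hX : X ∈ cellN N L'
    · exact Set.indicator_of_mem hX _
    · rw [Set.indicator_of_notMem hX]
      by_contra h
      exact hX (hsupp X (Ne.symm h))
  have hnorm : ∫⁻ X in cellN N L', (‖ψa X‖₊ : ℝ≥0∞) ^ 2 = 1 := by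
    rw [setLIntegral_eq_of_support_subset]
    · have h := lintegral_sub_right_eq_self (μ := (volume : Measure (Config N)))
        (fun X => (‖Ψ.ψ X‖₊ : ℝ≥0∞) ^ 2) (fun _ => a)
      exact h.trans Ψ.norm_eq
    · intro X hX
      by_contra hXc
      have h0 : ψa X = 0 := by
        by_contra h; exact hXc (hsupp X h)
      exact hX (by simp [h0])
  have henergy : ∫⁻ X in cellN N L', kineticDensity ψa X + interaction v X * (‖ψa X‖₊ : ℝ≥0∞) ^ 2 ≤
      ENNReal.ofReal ((4 * Real.pi * (scatteringLength v).toReal + τ) * ((N : ℝ) / L' ^ 3) * N) := by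
    refine (setLIntegral_le_lintegral _ _).trans (le_trans (le_of_eq ?_) hE)
    unfold energy
    have h := lintegral_sub_right_eq_self (μ := (volume : Measure (Config N)))
      (fun X => kineticDensity Ψ.ψ X + interaction v X * (‖Ψ.ψ X‖₊ : ℝ≥0∞) ^ 2) (fun _ => a)
    refine Eq.trans (lintegral_congr fun X => ?_) h
    show kineticDensity (fun Y => Ψ.ψ (Y - fun _ => a)) X + _ = _
    rw [kineticDensity_translate, ← interaction_sub_const v X a]
  have h := H N L' hL' hN hNρ ψa hC1 hsymm hnorm henergy K hK hK0 hwin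
  rw [hind] at h
  refine h.trans (le_of_eq (Finset.sum_congr rfl fun q _ => ?_))
  exact occupation_comp_add N (subMode (L' / (K : ℝ)) q) Ψ.ψ a

end Summit.AtomisticToContinuum.BoseEinsteinCondensation.Theorems.BlockLatticeFSumDirichletFloorShift

end
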